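import Literature.AlgebraicGeometry.Hu2025.Proofs.S03Pluecker.GammaQuadTorus
import HarnessLib

/-!
# Hu 2025 / [Hu22] p.131 — COORDINATES on the torus quotient `Gr_d/(𝔾⁹_m/𝔾_m)` of the complete quadrilateral (the normal-form
# slice `Rh ⧸ J`): the normal-form columns `n_a = (1, b_a, c_a)`, the four collinearity relations, the units, and the
# elimination of `c₆, c₈, b₉, c₉` (joint J1 / GAP-LEDGER-HU row HU-R01, reading (β): towards «`U` open in `𝔸⁶`» — kernel support, OURS)

**HONEST FRAMING (D-0012/D-0089).** [Hu2025] (arXiv:2507.21400v1) and [Hu2022] (arXiv:2203.03842v4) are unrefereed preprints under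
adjudication; nothing of them is asserted. OURS objects only (sequel of `GammaQuadTorus.lean`; typed carriers of rows 101/110).

[Hu22] Thm 9.4 (p.130 l.45–50) prints «there exists a positive integer `r` and an open subset `U ⊂ X × 𝔸^r` … such that `U` is
isomorphic to the quotient space `Gr̄_d := Gr_d/(𝔾ⁿ_m/𝔾_m)`» (row 110 h's field `r_pos`). For `d = quad` the quotient is our slice
`Spec (Rh ⧸ J)` (`GammaQuadTorus`); to exhibit it as an open subscheme of `𝔸⁶` one needs explicit coordinates. THIS FILE records,
in the slice ring `Slice k = Rh ⧸ J`, with `n_a := (A_{a,0}, A_{a,1}, A_{a,2}) mod J = (1, b_a, c_a)` (`a = 5..9`), `n₄ = (1,1,1)`: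
* `ms_eq_det3`: every chart coordinate `x̄_u` is the `3 × 3` minor of the normal-form columns; the Γ-relations
  `det(n₄,n₅,n₆) = det(n₄,n₇,n₈) = det(n₅,n₇,n₉) = det(n₆,n₈,n₉) = 0` (`rel456` …); the units `b₅ − 1 = x̄₃₄₅`, `b₇ − 1 = x̄₃₄₇`,
  `b₈ − b₆ = x̄₃₆₈`;
* ELIMINATION: `(b₅ − 1) c₆ = (b₅ − 1) + (c₅ − 1)(b₆ − 1)` (`c6_cleared`), likewise `c₈` (`c8_cleared`); `n₉` is the intersection of the
  lines `n₅n₇` and `n₆n₈`: `w · b₉ = v_y`, `w · c₉ = v_z` with `w = x̄₅₇₈ + x̄₅₆₇` (`cramer9`), and the UNIT CERTIFICATE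
  `(b₉ − b₆) · w = x̄₃₆₈ · x̄₅₆₇` (`w_certificate`), whence `w` is a unit (`isUnit_w`).
So `(b₅, c₅, b₆, b₇, c₇, b₈)` are free coordinates and the rest are rational in them with unit denominators — the input for the ring
isomorphism `Rh ⧸ J ≅ k[y₁..y₆][1/Δ]` (next file). AI proof is weaker than expert review.
-/

noncomputable section

namespace Literature.AlgebraicGeometry.Hu2025.Statements.S03Pluecker

open MvPolynomial Matrix

namespace QuadTorus

open QuadCell

variable (k : Type) [Field k]

/-! ## Normal-form columns and minors in the slice ring -/

/-- The quotient map `Rh → Rh ⧸ J`. OURS abbreviation.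
[cite: Hu2025, Thm. 9.4 p.161; [Hu22] p.131 l.6–16; joint J1 = GAP-LEDGER-HU row HU-R01 (unrefereed preprints under adjudication, D-0012/D-0089 — kernel support on OUR typed carriers of rows 101/110; nothing of the sources asserted)] -/
abbrev qJ : Rh k →+* Slice k := Ideal.Quotient.mk (J k)

/-- **The normal-form column `n_a`** (`= (A_{a,0}, A_{a,1}, A_{a,2})` modulo `J`). OURS.
[cite: Hu2025, Thm. 9.4 («Gr̄_d := Gr_d/(𝔾ⁿ_m/𝔾_m)») p.161; [Hu22] p.131 l.6–16; joint J1 = GAP-LEDGER-HU row HU-R01 (unrefereed preprints under adjudication, D-0012/D-0089 — kernel support on OUR typed carriers of rows 101/110; nothing of the sources asserted)] -/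
def nv (a : ℕ) : Fin 3 → Slice k := fun i => qJ k (A k a i)

/-- **The chart coordinate `x̄_u` on the slice** (`= m u` modulo `J`). OURS.
[cite: Hu2025, Prop. 9.1 (Gr_d) p.160 / Def. 7.1 (Z_Γ) p.128; [Hu22] p.131 l.6–16; joint J1 = GAP-LEDGER-HU row HU-R01 (unrefereed preprints under adjudication, D-0012/D-0089 — kernel support on OUR typed carriers of rows 101/110; nothing of the sources asserted)] -/
def ms (u : ℕ × ℕ × ℕ) : Slice k := qJ k (m k u)

/-- `x̄_u = det(n_{u₁}, n_{u₂}, n_{u₃})` on the slice.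
[cite: Hu2025, Prop. 9.1 (Gr_d) p.160 / Prop. 3.6 p.38; joint J1 = GAP-LEDGER-HU row HU-R01 (unrefereed preprints under adjudication, D-0012/D-0089 — kernel support on OUR typed carriers of rows 101/110; nothing of the sources asserted)] -/
theorem ms_eq_det3 {u : ℕ × ℕ × ℕ} (hu : u ∈ plVarSet 9) : ms k u = det3 (nv k u.1) (nv k u.2.1) (nv k u.2.2) := by
  rw [ms, m_eq_det3 k hu, map_det3]
  rfl

/-- `x̄_u = 0` on the slice for `u ∈ Γ`.
[cite: Hu2025, Def. 7.1 (Z_Γ) p.128; joint J1 = GAP-LEDGER-HU row HU-R01 (unrefereed preprints under adjudication, D-0012/D-0089 — kernel support on OUR typed carriers of rows 101/110; nothing of the sources asserted)] -/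
theorem ms_gamma {u : ℕ × ℕ × ℕ} (hu : u ∈ quadGamma) : ms k u = 0 := by
  rw [ms, m_gamma k hu, map_zero]

/-- `x̄_u` is a unit on the slice for `u ∉ Γ`.
[cite: Hu2025, Prop. 9.1 (Gr_d: «p_u ≠ 0, ∀ x_u ∈ Δ_d») p.160; joint J1 = GAP-LEDGER-HU row HU-R01 (unrefereed preprints under adjudication, D-0012/D-0089 — kernel support on OUR typed carriers of rows 101/110; nothing of the sources asserted)] -/
theorem isUnit_ms {u : ℕ × ℕ × ℕ} (hu : u ∈ offGamma) : IsUnit (ms k u) := (isUnit_m k hu).map (qJ k)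

/-- The frame columns `n₁, n₂, n₃`.
[cite: Hu2025, Prop. 3.6 ([I₃ | A]) p.38; joint J1 = GAP-LEDGER-HU row HU-R01 (unrefereed preprints under adjudication, D-0012/D-0089 — kernel support on OUR typed carriers of rows 101/110; nothing of the sources asserted)] -/
theorem nv_frame : nv k 1 = ![1, 0, 0] ∧ nv k 2 = ![0, 1, 0] ∧ nv k 3 = ![0, 0, 1] := by
  obtain ⟨f1, f2, f3⟩ := A_frame k
  refine ⟨?_, ?_, ?_⟩
  · funext i; simp only [nv, f1]; fin_cases i <;> simp
  · funext i; simp only [nv, f2]; fin_cases i <;> simp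
  · funext i; simp only [nv, f3]; fin_cases i <;> simp

/-- **Normal form**: `n₄ = (1,1,1)` and `n_a = (1, b_a, c_a)` for `3 < a ≤ 9`.
[cite: Hu2025, Thm. 9.4 p.161; [Hu22] p.131 l.6–16; joint J1 = GAP-LEDGER-HU row HU-R01 (unrefereed preprints under adjudication, D-0012/D-0089 — kernel support on OUR typed carriers of rows 101/110; nothing of the sources asserted)] -/
theorem nv_shape {a : ℕ} (ha : 3 < a) (ha9 : a ≤ 9) : nv k a = ![1, nv k a 1, nv k a 2] := by
  obtain ⟨g0, -⟩ := mk_A_eq_one k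
  refine vec3_eq ?_ rfl rfl
  simp only [Matrix.cons_val_zero]
  exact g0 a ha ha9

/-- `n₄ = (1, 1, 1)`.
[cite: Hu2025, Thm. 9.4 p.161; [Hu22] p.131 l.6–16; joint J1 = GAP-LEDGER-HU row HU-R01 (unrefereed preprints under adjudication, D-0012/D-0089 — kernel support on OUR typed carriers of rows 101/110; nothing of the sources asserted)] -/
theorem nv_four : nv k 4 = ![1, 1, 1] := by
  obtain ⟨-, g4⟩ := mk_A_eq_one k
  refine vec3_eq ?_ ?_ ?_
  · simp only [Matrix.cons_val_zero]; exact g4 0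
  · simp only [Matrix.cons_val_one, Matrix.cons_val_zero]; exact g4 1
  · simp only [Matrix.cons_val_two, Matrix.tail_cons, Matrix.head_cons]; exact g4 2

/-- **The slice coordinates `b_a := A_{a,1} mod J`, `c_a := A_{a,2} mod J`**. OURS.
[cite: Hu2025, Thm. 9.4 («Gr̄_d := Gr_d/(𝔾ⁿ_m/𝔾_m)») p.161; [Hu22] p.131 l.6–16; joint J1 = GAP-LEDGER-HU row HU-R01 (unrefereed preprints under adjudication, D-0012/D-0089 — kernel support on OUR typed carriers of rows 101/110; nothing of the sources asserted)] -/
def bq (a : ℕ) : Slice k := nv k a 1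

/-- The slice coordinate `c_a`. OURS.
[cite: Hu2025, Thm. 9.4 p.161; [Hu22] p.131 l.6–16; joint J1 = GAP-LEDGER-HU row HU-R01 (unrefereed preprints under adjudication, D-0012/D-0089 — kernel support on OUR typed carriers of rows 101/110; nothing of the sources asserted)] -/
def cq (a : ℕ) : Slice k := nv k a 2

/-- `n_a = (1, b_a, c_a)` for `3 < a ≤ 9`.
[cite: Hu2025, Thm. 9.4 p.161; [Hu22] p.131 l.6–16; joint J1 = GAP-LEDGER-HU row HU-R01 (unrefereed preprints under adjudication, D-0012/D-0089 — kernel support on OUR typed carriers of rows 101/110; nothing of the sources asserted)] -/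
theorem nv_eq {a : ℕ} (ha : 3 < a) (ha9 : a ≤ 9) : nv k a = ![1, bq k a, cq k a] := nv_shape k ha ha9

/-- `b₄ = 1` and `c₄ = 1`.
[cite: Hu2025, Thm. 9.4 p.161; [Hu22] p.131 l.6–16; joint J1 = GAP-LEDGER-HU row HU-R01 (unrefereed preprints under adjudication, D-0012/D-0089 — kernel support on OUR typed carriers of rows 101/110; nothing of the sources asserted)] -/
theorem bq_four : bq k 4 = 1 ∧ cq k 4 = 1 := by
  obtain ⟨-, g4⟩ := mk_A_eq_one k
  exact ⟨g4 1, g4 2⟩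

/-- The generic `3 × 3` minor of three normal-form columns `(1,b,c)`.
[cite: Hu2025, Prop. 9.1 (Gr_d) p.160; joint J1 = GAP-LEDGER-HU row HU-R01 (unrefereed preprints under adjudication, D-0012/D-0089 — kernel support on OUR typed carriers of rows 101/110; nothing of the sources asserted)] -/
theorem det3_ones {R : Type*} [CommRing R] (b₁ c₁ b₂ c₂ b₃ c₃ : R) :
    det3 ![1, b₁, c₁] ![1, b₂, c₂] ![1, b₃, c₃] = (b₂ - b₁) * (c₃ - c₁) - (c₂ - c₁) * (b₃ - b₁) := by
  simp only [det3_eq, Matrix.cons_val_zero, Matrix.cons_val_one, Matrix.cons_val_two, Matrix.tail_cons, Matrix.head_cons]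
  ring

/-- **Minors through two normal-form columns**: `x̄_{(3,a,b)} = b_b − b_a`, `x̄_{(2,a,b)} = c_a − c_b`, `x̄_{(1,a,b)} = b_a c_b − c_a b_b`
(`3 < a < b ≤ 9`).
[cite: Hu2025, Prop. 9.1 (Gr_d) p.160 / Prop. 3.6 p.38; joint J1 = GAP-LEDGER-HU row HU-R01 (unrefereed preprints under adjudication, D-0012/D-0089 — kernel support on OUR typed carriers of rows 101/110; nothing of the sources asserted)] -/
theorem ms_frame {a b : ℕ} (ha : 3 < a) (hab : a < b) (hb : b ≤ 9) :
    ms k (3, a, b) = bq k b - bq k a ∧ ms k (2, a, b) = cq k a - cq k b ∧ ms k (1, a, b) = bq k a * cq k b - cq k a * bq k b := by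
  obtain ⟨f1, f2, f3⟩ := nv_frame k
  have ea := nv_eq k ha (by omega)
  have eb := nv_eq k (a := b) (by omega) hb
  refine ⟨?_, ?_, ?_⟩
  · rw [ms_eq_det3 k (mem9 (by norm_num) (by omega) hab hb (by omega))]
    simp only [f3, ea, eb, det3_eq, Matrix.cons_val_zero, Matrix.cons_val_one, Matrix.cons_val_two, Matrix.tail_cons,
      Matrix.head_cons]
    ring
  · rw [ms_eq_det3 k (mem9 (by norm_num) (by omega) hab hb (by omega))]
    simp only [f2, ea, eb, det3_eq, Matrix.cons_val_zero, Matrix.cons_val_one, Matrix.cons_val_two, Matrix.tail_cons,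
      Matrix.head_cons]
    ring
  · rw [ms_eq_det3 k (mem9 (by norm_num) (by omega) hab hb (by omega))]
    simp only [f1, ea, eb, det3_eq, Matrix.cons_val_zero, Matrix.cons_val_one, Matrix.cons_val_two, Matrix.tail_cons,
      Matrix.head_cons]
    ring

/-- **Minors of three normal-form columns**: `x̄_{(a,b,c)} = (b_b − b_a)(c_c − c_a) − (c_b − c_a)(b_c − b_a)` (`3 < a < b < c ≤ 9`).
[cite: Hu2025, Prop. 9.1 (Gr_d) p.160 / Prop. 3.6 p.38; joint J1 = GAP-LEDGER-HU row HU-R01 (unrefereed preprints under adjudication, D-0012/D-0089 — kernel support on OUR typed carriers of rows 101/110; nothing of the sources asserted)] -/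
theorem ms_three {a b c : ℕ} (ha : 3 < a) (hab : a < b) (hbc : b < c) (hc : c ≤ 9) :
    ms k (a, b, c) = (bq k b - bq k a) * (cq k c - cq k a) - (cq k b - cq k a) * (bq k c - bq k a) := by
  rw [ms_eq_det3 k (mem9 (by omega) hab hbc hc (by omega)), nv_eq k ha (by omega), nv_eq k (a := b) (by omega) (by omega),
    nv_eq k (a := c) (by omega) hc]
  exact det3_ones _ _ _ _ _ _

/-! ## The four relations and the units -/

/-- **The Γ-relations on the slice**: `x̄₄₅₆ = x̄₄₇₈ = x̄₅₇₉ = x̄₆₈₉ = 0` in coordinates.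
[cite: Hu2025, Def. 7.1 (Z_Γ: x_u = 0 for u ∈ Γ) p.128 / (9.3) Γ_d; joint J1 = GAP-LEDGER-HU row HU-R01 (unrefereed preprints under adjudication, D-0012/D-0089 — kernel support on OUR typed carriers of rows 101/110; nothing of the sources asserted)] -/
theorem relations :
    (bq k 5 - 1) * (cq k 6 - 1) - (cq k 5 - 1) * (bq k 6 - 1) = 0 ∧
    (bq k 7 - 1) * (cq k 8 - 1) - (cq k 7 - 1) * (bq k 8 - 1) = 0 ∧
    (bq k 7 - bq k 5) * (cq k 9 - cq k 5) - (cq k 7 - cq k 5) * (bq k 9 - bq k 5) = 0 ∧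
    (bq k 8 - bq k 6) * (cq k 9 - cq k 6) - (cq k 8 - cq k 6) * (bq k 9 - bq k 6) = 0 := by
  obtain ⟨b4, c4⟩ := bq_four k
  refine ⟨?_, ?_, ?_, ?_⟩
  · have h := ms_three k (a := 4) (b := 5) (c := 6) (by norm_num) (by norm_num) (by norm_num) (by norm_num)
    rw [ms_gamma k (by simp [quadGamma]), b4, c4] at h
    exact h.symm
  · have h := ms_three k (a := 4) (b := 7) (c := 8) (by norm_num) (by norm_num) (by norm_num) (by norm_num)
    rw [ms_gamma k (by simp [quadGamma]), b4, c4] at h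
    exact h.symm
  · have h := ms_three k (a := 5) (b := 7) (c := 9) (by norm_num) (by norm_num) (by norm_num) (by norm_num)
    rw [ms_gamma k (by simp [quadGamma])] at h
    exact h.symm
  · have h := ms_three k (a := 6) (b := 8) (c := 9) (by norm_num) (by norm_num) (by norm_num) (by norm_num)
    rw [ms_gamma k (by simp [quadGamma])] at h
    exact h.symm

/-- membership of the triples used as units (bookkeeping).
[cite: Hu2025, Prop. 9.1 (Gr_d) p.160; joint J1 = GAP-LEDGER-HU row HU-R01 (unrefereed preprints under adjudication, D-0012/D-0089 — kernel support on OUR typed carriers of rows 101/110; nothing of the sources asserted)] -/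
theorem mem_offGamma' :
    ((3,4,5) : ℕ × ℕ × ℕ) ∈ offGamma ∧ ((3,4,7) : ℕ × ℕ × ℕ) ∈ offGamma ∧ ((3,6,8) : ℕ × ℕ × ℕ) ∈ offGamma ∧
    ((5,6,7) : ℕ × ℕ × ℕ) ∈ offGamma ∧ ((5,7,8) : ℕ × ℕ × ℕ) ∈ offGamma := by
  refine ⟨?_, ?_, ?_, ?_, ?_⟩ <;>
    exact Finset.mem_filter.mpr ⟨mem_plVarSet (by norm_num) (by norm_num) (by norm_num) (by norm_num) (by norm_num),
      by simp [quadGammaFin]⟩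

/-- **Units**: `b₅ − 1 = x̄₃₄₅`, `b₇ − 1 = x̄₃₄₇`, `b₈ − b₆ = x̄₃₆₈` are units of the slice ring.
[cite: Hu2025, Prop. 9.1 (Gr_d: «p_u ≠ 0, ∀ x_u ∈ Δ_d») p.160; joint J1 = GAP-LEDGER-HU row HU-R01 (unrefereed preprints under adjudication, D-0012/D-0089 — kernel support on OUR typed carriers of rows 101/110; nothing of the sources asserted)] -/
theorem units_b : IsUnit (bq k 5 - 1) ∧ IsUnit (bq k 7 - 1) ∧ IsUnit (bq k 8 - bq k 6) := by
  obtain ⟨h345, h347, h368, -, -⟩ := mem_offGamma'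
  obtain ⟨b4, -⟩ := bq_four k
  refine ⟨?_, ?_, ?_⟩
  · have e := (ms_frame k (a := 4) (b := 5) (by norm_num) (by norm_num) (by norm_num)).1
    rw [b4] at e; rw [← e]; exact isUnit_ms k h345
  · have e := (ms_frame k (a := 4) (b := 7) (by norm_num) (by norm_num) (by norm_num)).1
    rw [b4] at e; rw [← e]; exact isUnit_ms k h347
  · have e := (ms_frame k (a := 6) (b := 8) (by norm_num) (by norm_num) (by norm_num)).1
    rw [← e]; exact isUnit_ms k h368

/-! ## Elimination of `c₆, c₈` and of `n₉` -/

/-- **`c₆` eliminated (cleared form)**: `(b₅ − 1) c₆ = (b₅ − 1) + (c₅ − 1)(b₆ − 1)`; likewise `c₈`.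
[cite: Hu2025, Def. 7.1 (Z_Γ) p.128 / Thm. 9.4 (Gr̄_d) p.161; joint J1 = GAP-LEDGER-HU row HU-R01 (unrefereed preprints under adjudication, D-0012/D-0089 — kernel support on OUR typed carriers of rows 101/110; nothing of the sources asserted)] -/
theorem c6_c8_cleared :
    (bq k 5 - 1) * cq k 6 = (bq k 5 - 1) + (cq k 5 - 1) * (bq k 6 - 1) ∧
    (bq k 7 - 1) * cq k 8 = (bq k 7 - 1) + (cq k 7 - 1) * (bq k 8 - 1) := by
  obtain ⟨r1, r2, -, -⟩ := relations k
  exact ⟨by linear_combination r1, by linear_combination r2⟩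

/-- **`w := x̄₅₇₈ + x̄₅₆₇`** — the determinant of the linear system «`n₉` lies on the lines `n₅n₇` and `n₆n₈`». OURS.
[cite: Hu2025, Def. 7.1 (Z_Γ) p.128 / Thm. 9.4 (Gr̄_d) p.161; joint J1 = GAP-LEDGER-HU row HU-R01 (unrefereed preprints under adjudication, D-0012/D-0089 — kernel support on OUR typed carriers of rows 101/110; nothing of the sources asserted)] -/
def w : Slice k := ms k (5, 7, 8) + ms k (5, 6, 7)

/-- `w` in coordinates.
[cite: Hu2025, Def. 7.1 (Z_Γ) p.128 / Thm. 9.4 p.161; joint J1 = GAP-LEDGER-HU row HU-R01 (unrefereed preprints under adjudication, D-0012/D-0089 — kernel support on OUR typed carriers of rows 101/110; nothing of the sources asserted)] -/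
theorem w_eq : w k = ((bq k 7 - bq k 5) * (cq k 8 - cq k 5) - (cq k 7 - cq k 5) * (bq k 8 - bq k 5)) +
    ((bq k 6 - bq k 5) * (cq k 7 - cq k 5) - (cq k 6 - cq k 5) * (bq k 7 - bq k 5)) := by
  rw [w, ms_three k (by norm_num) (by norm_num) (by norm_num) (by norm_num),
    ms_three k (by norm_num) (by norm_num) (by norm_num) (by norm_num)]

/-- **CRAMER for `n₉`**: `w · b₉ = b₆ x̄₅₇₈ + b₈ x̄₅₆₇` and `w · c₉ = c₆ x̄₅₇₈ + c₈ x̄₅₆₇` (the intersection of the lines `n₅n₇`, `n₆n₈`).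
[cite: Hu2025, Def. 7.1 (Z_Γ) p.128 / Thm. 9.4 (Gr̄_d) p.161; joint J1 = GAP-LEDGER-HU row HU-R01 (unrefereed preprints under adjudication, D-0012/D-0089 — kernel support on OUR typed carriers of rows 101/110; nothing of the sources asserted)] -/
theorem cramer9 :
    w k * bq k 9 = bq k 6 * ms k (5, 7, 8) + bq k 8 * ms k (5, 6, 7) ∧
    w k * cq k 9 = cq k 6 * ms k (5, 7, 8) + cq k 8 * ms k (5, 6, 7) := by
  obtain ⟨-, -, r3, r4⟩ := relations k
  rw [w, ms_three k (by norm_num) (by norm_num) (by norm_num) (by norm_num),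
    ms_three k (a := 5) (b := 6) (c := 7) (by norm_num) (by norm_num) (by norm_num) (by norm_num)]
  refine ⟨?_, ?_⟩
  · linear_combination (bq k 8 - bq k 6) * r3 - (bq k 7 - bq k 5) * r4
  · linear_combination (cq k 8 - cq k 6) * r3 - (cq k 7 - cq k 5) * r4

/-- **UNIT CERTIFICATE for `w`**: `(b₉ − b₆) · w = x̄₃₆₈ · x̄₅₆₇`.
[cite: Hu2025, Def. 7.1 (Z_Γ) p.128 / Prop. 9.1 (Gr_d) p.160; joint J1 = GAP-LEDGER-HU row HU-R01 (unrefereed preprints under adjudication, D-0012/D-0089 — kernel support on OUR typed carriers of rows 101/110; nothing of the sources asserted)] -/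
theorem w_certificate : (bq k 9 - bq k 6) * w k = ms k (3, 6, 8) * ms k (5, 6, 7) := by
  obtain ⟨-, -, r3, r4⟩ := relations k
  rw [w_eq, (ms_frame k (a := 6) (b := 8) (by norm_num) (by norm_num) (by norm_num)).1,
    ms_three k (a := 5) (b := 6) (c := 7) (by norm_num) (by norm_num) (by norm_num) (by norm_num)]
  linear_combination (bq k 8 - bq k 6) * r3 - (bq k 7 - bq k 5) * r4

/-- **`w` is a unit of the slice ring** (the lines `n₅n₇` and `n₆n₈` meet at the affine point `n₉`).
[cite: Hu2025, Def. 7.1 (Z_Γ) p.128 / Prop. 9.1 (Gr_d) p.160 / Thm. 9.4 p.161; joint J1 = GAP-LEDGER-HU row HU-R01 (unrefereed preprints under adjudication, D-0012/D-0089 — kernel support on OUR typed carriers of rows 101/110; nothing of the sources asserted)] -/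
theorem isUnit_w : IsUnit (w k) := by
  obtain ⟨-, -, h368, h567, -⟩ := mem_offGamma'
  have hu : IsUnit ((bq k 9 - bq k 6) * w k) := by
    rw [w_certificate]; exact (isUnit_ms k h368).mul (isUnit_ms k h567)
  exact isUnit_of_mul_isUnit_right hu

end QuadTorus

end Literature.AlgebraicGeometry.Hu2025.Statements.S03Pluecker

end
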